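import Summits.CriticalPhenomena.Ising3D.Control2DL19OpeUC
import Summits.CriticalPhenomena.Ising3D.Control2DL19OpeLC
import Mathlib.Tactic.NormNum
import HarnessLib

/-!
# The 2D control's `c` datum TWO-SIDED on the kernel path at Λ = 19: `0.4999744 < c < 0.5040323`
(cell `pub-ising3x`, seat controls-1 gen 21; KERNEL PATH for the 2D γ-certificates, kind `ope2`, both senses — CONTROL-ONLY)

HONEST FRAMING: lottery ticket; floor = tightest certified 3D Ising CFT bounds; no exact-solution
claim without a proof. CONTROL-ONLY: `d = 2`, global blocks, `Δ_σ = 1/8` exact, the 2D axiom set `A2D′` with the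
CERTIFIED `ε` box `[49/50, 20001/20000]` as scalar input (scalars in the box `∪ [2, ∞)`, stress tensor at `(2,2)` + spin-2 gap `1`,
unitarity) and the Virasoro Ward identity `p_T = Δ_σ²/(2c)` as a HYPOTHESIS on the datum; nothing about `d = 3`.

`Control2DOpeTwoSided.cTwoSided_rb6_L19` (controls-1 g12) took the two RB-6 `ope2` certificates j137649 / j137089 (Λ = 19, E₀ = 48; lower P = 31/2000, upper P = 78129/5000000) as
HYPOTHESES (`hlo : OpeLowerA2D …`, `hhi : OpeUpperA2D …`, each reader A ∧ reader B PASS). Both are now THEOREMS with every obligation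
re-decided in the Lean kernel: `opeUpper_2d_L19_opeUC` (`Control2DL19OpeUC`, controls-1 g20, bridge `opeUpper_half_of_cellsZ`) and `opeLower_2d_L19_opeLC`
(`Control2DL19OpeLC`, controls-1 g21, bridge `opeLower_half_of_cellsZ` with the explicit tail majorant of `Control2DOpeTail`). This file only
composes them: **`cTwoSided_2d_L19`** — for every parity-symmetric unitary solution of the 2D `⟨σσσσ⟩` sum rule at `Δ_σ = 1/8` under `A2D′`
with that `ε` box whose total `(2,2)` coefficient is `(1/8)²/(2c)`, `c > 0`: `78125/156258 ≈ 0.4999744 < c < 125/248 ≈ 0.5040323`; the 2D Ising value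
`c = 1/2` lies inside. Zero grant compute. No facts, standard axioms only. [cite: RattazziEtAl2008, §5]
-/

namespace Summit.CriticalPhenomena.Ising3D.Control2D

open Set
open Literature.MathematicalPhysics.QuantumFieldTheory.ConformalBootstrap3D

/-- **2D control, `c` two-sided, kernel-complete at Λ = 19**: `CTwoSided (1/8) 2 1 (49/50) (20001/20000) ((1/8)²/(2·P_hi)) ((1/8)²/(2·P_lo))`
with `P_hi = 78129/5000000`, `P_lo = 31/2000`, i.e. `78125/156258 ≈ 0.4999744 < c < 125/248 ≈ 0.5040323` — `cTwoSided_rb6_L19` with BOTH hypotheses discharged by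
kernel replays. CONTROL-ONLY (d = 2). [cite: RattazziEtAl2008, §5] -/
theorem cTwoSided_2d_L19 :
    CTwoSided (1 / 8) 2 1 (49 / 50) (20001 / 20000)
      ((1 / 8 : ℝ) ^ 2 / (2 * (78129 / 5000000))) ((1 / 8 : ℝ) ^ 2 / (2 * (31 / 2000))) :=
  cTwoSided_rb6_L19 opeLower_2d_L19_opeLC
    opeUpper_2d_L19_opeUC

end Summit.CriticalPhenomena.Ising3D.Control2D
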